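import Literature.AlgebraicGeometry.Motives.HodgeLieWeightOneRankFourCenter
import Literature.RepresentationTheory.GeneralLinear.SL2TripleCommutant
import HarnessLib

/-!
# Weight-one Hodge structures with Hodge group of rank four, not of CM type. D: the `𝔰𝔩₂`-part of `(Lie Hg)_ℂ`
# kills the range of the rational central element `φ`

Family `hodge`, layer `Literature/AlgebraicGeometry/Motives`; THEOREMS ONLY (no definition, no named fact; D-0026).
Fourth file of the lane MT-RANK-FIVE of the cell `pub-hodgecm2` (setting as in `Motives/HodgeLieWeightOneRankFourBlocks`,
with `dim_ℚ 𝔥 = 4`, `X ∈ 𝔥 ∖ End_Hdg(V)`; `φ` the rational central element of `Motives/HodgeLieWeightOneRankFourCenter`,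
`𝔥_ℂ = ℂ(2P−1) ⊕ ℂE ⊕ ℂF ⊕ ℂφ_ℂ`, `[E, F] = α(2P−1) + βφ_ℂ`).

* §1 `commutator_mem_span_brackets` — `[W, W'] ∈ span_ℂ {[X'_ℂ, X''_ℂ] | X', X'' ∈ 𝔥}` for `W, W' ∈ 𝔥_ℂ` (bilinearity;
  the derived algebra of `𝔥_ℂ` is spanned by brackets of RATIONAL elements).
* §2 `exists_rat_central_mul_projE_eq_zero` — **`β ≠ 0`, `φ_ℂ E = 0` and `φ_ℂ F = 0`.**  Were `β = 0`, then `E F = αP`,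
  `F E = α(1 − P)`, `α ≠ 0`; a `ℂ`-linear `T` commuting with `P, E, F` commutes with every bracket `[W, W']`
  (`W, W' ∈ 𝔥_ℂ`; `φ_ℂ` is central), in particular with the `[X', X'']_ℂ`, so by commutant descent
  (`mem_span_baseChange_of_forall_commute`) `T` is a combination of `b_ℂ` with `b` rational commuting with all `[X', X'']`;
  such `b_ℂ` commute with `[E, F] = α(2P − 1)`, hence `b ∈ End_Hdg(V)` (`mem_endAlg_of_projE_eq_zero`) commutes with `φ`;
  so `φ_ℂ` is central in the commutant of the `𝔰𝔩₂`-triple, hence scalar (`SL2Triple.exists_eq_smul_one_of_mem_center_commutant`),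
  so `φ ∈ ℚ · id ∩ 𝔥 = 0` (`id_notMem_hodgeLie`) — contradiction.  With `β ≠ 0`: the corners of `[E, F]` give
  `E F = αP + βφ_ℂP`, `F E = α(1−P) − βφ_ℂ(1−P)`, and `E F E` computed both ways gives `2β φ_ℂ E = 0`.

Classically: `Hg⁰ = SL₂ · U(1)` and the `U(1)` acts trivially where `SL₂` acts non-trivially — a simple abelian variety
cannot have Hodge group `SL₂ · U(1)` with `U(1)` central non-trivial (the Hodge cocharacter would factor through the
derived group on such a factor).  The sequel `Motives/HodgeLieWeightOneRankFourCube` derives `φ³ = qφ` and the splitting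
`V = ker φ ⊕ range φ`.

## References

* [MoonenZarhin1999LowDim] B. Moonen, Yu. Zarhin, *Hodge classes on abelian varieties of low dimension*, Math. Ann. 315
  (1999), §2 (Hodge group, reductivity, `End⁰ = End_{Hg} H¹`).
* [Deligne1982HodgeCycles] P. Deligne, *Hodge cycles on abelian varieties*, LNM 900 (1982), I §3 (3.1–3.4).
* [FultonHarris1991] W. Fulton, J. Harris, *Representation Theory*, GTM 129 (1991), Lecture 11 (§11.1), §9.3.
* [Zarhin1983HodgeGroupsK3] Yu. G. Zarhin, *Hodge groups of K3 surfaces*, J. reine angew. Math. 341 (1983), §2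
  (commutant descent).
* [Humphreys1972] J. E. Humphreys, *Introduction to Lie Algebras and Representation Theory*, GTM 9, §6.1 (Schur).
-/

noncomputable section

open scoped TensorProduct

namespace Literature.AlgebraicGeometry.Motives

universe u

namespace HodgeStructure

open ProjectorBlocks Literature.RepresentationTheory.GeneralLinear

variable {V : Type u} [AddCommGroup V] [Module ℚ V] [Module.Finite ℚ V] [HodgeTensorFacts.{u, u}] {n : ℤ}
  {S : Type u} [Fintype S] [DecidableEq S] {deg : S → ℤ}

/-! ## §1 The derived algebra of `𝔥_ℂ` is spanned by brackets of rational elements -/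

/-- **`[W, W'] ∈ span_ℂ {X'_ℂ X''_ℂ − X''_ℂ X'_ℂ | X', X'' ∈ 𝔥}`** for `W, W' ∈ 𝔥_ℂ = span_ℂ {X_ℂ | X ∈ 𝔥}` (the bracket
is bilinear). [cite: FultonHarris1991, §9.3] -/
theorem commutator_mem_span_brackets (H : HodgeStructure V n) {W W' : Module.End ℂ (ℂ ⊗[ℚ] V)}
    (hW : W ∈ H.hodgeLieC) (hW' : W' ∈ H.hodgeLieC) :
    W * W' - W' * W ∈ Submodule.span ℂ ((fun p : Module.End ℚ V × Module.End ℚ V =>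
      p.1.baseChange ℂ * p.2.baseChange ℂ - p.2.baseChange ℂ * p.1.baseChange ℂ) ''
        ((H.hodgeLie : Set (Module.End ℚ V)) ×ˢ (H.hodgeLie : Set (Module.End ℚ V)))) := by
  set Sbr := Submodule.span ℂ ((fun p : Module.End ℚ V × Module.End ℚ V =>
      p.1.baseChange ℂ * p.2.baseChange ℂ - p.2.baseChange ℂ * p.1.baseChange ℂ) ''
        ((H.hodgeLie : Set (Module.End ℚ V)) ×ˢ (H.hodgeLie : Set (Module.End ℚ V)))) with hSbr
  induction hW using Submodule.span_induction generalizing W' with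
  | mem W₁ hW₁ =>
    obtain ⟨X₁, hX₁, rfl⟩ := hW₁
    induction hW' using Submodule.span_induction with
    | mem W₂ hW₂ =>
      obtain ⟨X₂, hX₂, rfl⟩ := hW₂
      exact Submodule.subset_span ⟨(X₁, X₂), ⟨hX₁, hX₂⟩, rfl⟩
    | zero => simp
    | add x y _ _ hx hy =>
      have h : X₁.baseChange ℂ * (x + y) - (x + y) * X₁.baseChange ℂ =
          (X₁.baseChange ℂ * x - x * X₁.baseChange ℂ) + (X₁.baseChange ℂ * y - y * X₁.baseChange ℂ) := by
        rw [mul_add, add_mul]; abel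
      rw [h]; exact Sbr.add_mem hx hy
    | smul c x _ hx =>
      have h : X₁.baseChange ℂ * (c • x) - c • x * X₁.baseChange ℂ = c • (X₁.baseChange ℂ * x - x * X₁.baseChange ℂ) := by
        rw [mul_smul_comm, smul_mul_assoc, smul_sub]
      rw [h]; exact Sbr.smul_mem c hx
  | zero => simp
  | add x y _ _ hx hy =>
    have h : (x + y) * W' - W' * (x + y) = (x * W' - W' * x) + (y * W' - W' * y) := by rw [add_mul, mul_add]; abel
    rw [h]; exact Sbr.add_mem (hx hW') (hy hW')
  | smul c x _ hx =>
    have h : c • x * W' - W' * (c • x) = c • (x * W' - W' * x) := by rw [smul_mul_assoc, mul_smul_comm, smul_sub]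
    rw [h]; exact Sbr.smul_mem c (hx hW')

/-! ## §2 `β ≠ 0`, and the `𝔰𝔩₂`-part kills `range φ` -/

omit [Module.Finite ℚ V] [HodgeTensorFacts.{u, u}] [Fintype S] [DecidableEq S] in
/-- If `T` commutes with `A` and `B` it commutes with `A B − B A`. [cite: FultonHarris1991, §9.3] -/
private theorem commute_bracket {R : Type*} [Ring R] {T A B : R} (hA : T * A = A * T) (hB : T * B = B * T) :
    T * (A * B - B * A) = (A * B - B * A) * T := by
  have h1 : T * (A * B) = A * B * T := by rw [← mul_assoc, hA, mul_assoc, hB, ← mul_assoc]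
  have h2 : T * (B * A) = B * A * T := by rw [← mul_assoc, hB, mul_assoc, hA, ← mul_assoc]
  rw [mul_sub, sub_mul, h1, h2]

/-- **The `𝔰𝔩₂`-part of `Lie Hg ⊗ ℂ` kills the range of the rational central element.**  For `X ∈ 𝔥 ∖ End_Hdg(V)`
and `dim_ℚ 𝔥 = 4` (polarizable weight-one `H`, degrees in `{0,1}`), the rational central `φ` of
`exists_rat_central_of_finrank_eq_four` (a non-zero Hodge endomorphism in `𝔥`, central in `End_Hdg(V)`, with
`𝔥_ℂ = ℂ(2P−1) ⊕ ℂE ⊕ ℂF ⊕ ℂφ_ℂ`) satisfies **`φ_ℂ E = 0`, `φ_ℂ F = 0`**, and `[E, F] = α(2P−1) + βφ_ℂ` with **`β ≠ 0`**.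
If `β = 0` the triple `(P, E, F)` is in isotypic position (`E F = αP`, `F E = α(1−P)`, `α ≠ 0`), every `T` commuting
with `P, E, F` commutes with all brackets of `𝔥_ℂ` (`φ_ℂ` is central), hence (commutant descent
`mem_span_baseChange_of_forall_commute` for the set of rational brackets, whose complex span contains `[E,F] = α(2P−1)`,
and `mem_endAlg_of_projE_eq_zero`) with `φ_ℂ`; so `φ_ℂ` is a scalar (`SL2Triple.exists_eq_smul_one_of_mem_center_commutant`)
and `φ ∈ ℚ·id ∩ 𝔥`, contradicting `id_notMem_hodgeLie`.  With `β ≠ 0`, `E F E = αE + βφ_ℂE = αE − βφ_ℂE` gives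
`φ_ℂ E = 0`, and symmetrically `φ_ℂ F = 0`. [cite: MoonenZarhin1999LowDim, §2] [cite: Zarhin1983HodgeGroupsK3, §2]
[cite: FultonHarris1991, Lecture 11 (§11.1)] -/
theorem exists_rat_central_mul_projE_eq_zero (H : HodgeStructure V n) (ψ : H.Polarization) (hn : n = 1)
    (e : Module.Basis S ℂ (ℂ ⊗[ℚ] V)) (hF : ∀ a, H.F a = Submodule.span ℂ (e '' {σ | a ≤ deg σ}))
    (hFc : ∀ a, complexConj (H.F a) = Submodule.span ℂ (e '' {σ | deg σ ≤ n - a}))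
    (hdeg : ∀ σ, deg σ = 0 ∨ deg σ = 1) {X : Module.End ℚ V} (hX : X ∈ H.hodgeLie) (hXE : X ∉ H.endAlg)
    (h4 : Module.finrank ℚ H.hodgeLie = 4) :
    ∃ φ : Module.End ℚ V, φ ∈ H.hodgeLie ∧ φ ≠ 0 ∧ φ ∈ H.endAlg ∧ (∀ a ∈ H.endAlg, φ * a = a * φ) ∧
      LinearIndependent ℂ ![(2 : ℂ) • gradingEnd e deg - 1,
        gradingEnd e deg * X.baseChange ℂ * (1 - gradingEnd e deg),
        (1 - gradingEnd e deg) * X.baseChange ℂ * gradingEnd e deg, φ.baseChange ℂ] ∧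
      (∀ W ∈ H.hodgeLieC, ∃ c : Fin 4 → ℂ, W = c 0 • ((2 : ℂ) • gradingEnd e deg - 1) +
        c 1 • (gradingEnd e deg * X.baseChange ℂ * (1 - gradingEnd e deg)) +
        c 2 • ((1 - gradingEnd e deg) * X.baseChange ℂ * gradingEnd e deg) + c 3 • φ.baseChange ℂ) ∧
      φ.baseChange ℂ * (gradingEnd e deg * X.baseChange ℂ * (1 - gradingEnd e deg)) = 0 ∧
      φ.baseChange ℂ * ((1 - gradingEnd e deg) * X.baseChange ℂ * gradingEnd e deg) = 0 ∧
      ∃ α β : ℂ, β ≠ 0 ∧ (gradingEnd e deg * X.baseChange ℂ * (1 - gradingEnd e deg)) *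
          ((1 - gradingEnd e deg) * X.baseChange ℂ * gradingEnd e deg) -
        ((1 - gradingEnd e deg) * X.baseChange ℂ * gradingEnd e deg) *
          (gradingEnd e deg * X.baseChange ℂ * (1 - gradingEnd e deg)) =
        α • ((2 : ℂ) • gradingEnd e deg - 1) + β • φ.baseChange ℂ := by
  classical
  subst hn
  obtain ⟨φ, hφh, hφ0, hφA, hφcA, hli, hspan, α, β, hEF⟩ :=
    exists_rat_central_of_finrank_eq_four H ψ rfl e hF hFc hdeg hX hXE h4
  have hFE0 := projF_mul_projE_ne_zero H ψ rfl e hF hFc hdeg hX hXE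
  set P := gradingEnd e deg with hP
  set Y := X.baseChange ℂ with hY
  set E := P * Y * (1 - P) with hEdef
  set F := (1 - P) * Y * P with hFdef
  have hPP : P * P = P := gradingEnd_mul_gradingEnd_of_deg e hdeg
  have hPE : P * E = E := by rw [hEdef, ← mul_assoc, ← mul_assoc, hPP]
  have hEP : E * P = 0 := by rw [hEdef, mul_assoc (P * Y) (1 - P) P, sub_mul, one_mul, hPP, sub_self, mul_zero]
  have hPF : P * F = 0 := by
    rw [hFdef, mul_assoc (1 - P) Y P, ← mul_assoc P (1 - P) (Y * P), mul_sub, mul_one, hPP, sub_self, zero_mul]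
  have hFP : F * P = F := by rw [hFdef, mul_assoc ((1 - P) * Y) P P, hPP]
  have hEQ : E * (1 - P) = E := by rw [mul_sub, mul_one, hEP, sub_zero]
  have hQF : (1 - P) * F = F := by rw [sub_mul, one_mul, hPF, sub_zero]
  obtain ⟨hE0, hF0⟩ := projE_ne_zero_of_not_mem_endAlg H rfl e hF hFc hdeg hXE
  rw [← hP, ← hY, ← hEdef] at hE0; rw [← hP, ← hY, ← hFdef] at hF0
  have hYM : Y ∈ H.hodgeLieC := H.baseChange_mem_hodgeLieC hX
  obtain ⟨hEM, hFM⟩ := projE_mem_hodgeLieC H e hF hFc hdeg hYM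
  rw [← hP, ← hEdef] at hEM; rw [← hP, ← hFdef] at hFM
  have hΘ' : (2 : ℂ) • P - 1 ∈ H.hodgeLieC := by
    simpa only [Int.cast_one, one_smul] using two_smul_gradingEnd_sub_mem_hodgeLieC H e hF hFc
  set Φ := φ.baseChange ℂ with hΦdef
  have hΦcen : ∀ W ∈ H.hodgeLieC, Φ * W = W * Φ :=
    fun W hW => (commute_baseChange_of_mem_hodgeLieC H hW ⟨φ, hφA⟩).symm
  have hΦP : Φ * P = P * Φ := by
    have h := hΦcen _ hΘ'
    rw [mul_sub Φ _ 1, sub_mul _ 1 Φ, mul_one, one_mul, mul_smul_comm, smul_mul_assoc, sub_left_inj] at h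
    exact smul_right_injective _ (two_ne_zero' ℂ) h
  have hΦE : Φ * E = E * Φ := hΦcen _ hEM
  have hΦF : Φ * F = F * Φ := hΦcen _ hFM
  -- corners of `[E, F] = α(2P−1) + βΦ`
  have hEFc : E * F = α • P + β • (Φ * P) := by
    have h := (corners_comm hPE hEP hPF hFP).1
    rw [hEF, mul_add, add_mul, mul_smul_comm, mul_smul_comm, smul_mul_assoc, smul_mul_assoc, (mul_theta hPP).1, hPP,
      ← hΦP, mul_assoc Φ P P, hPP] at h
    exact h.symm
  have hFEc : F * E = α • (1 - P) - β • (Φ * (1 - P)) := by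
    have h : F * E = E * F - (E * F - F * E) := by rw [sub_sub_cancel]
    rw [h, hEF, hEFc, mul_sub Φ 1 P, mul_one]
    module
  -- `E F E` and `F E F` computed both ways: `2β Φ E = 0`, `2β Φ F = 0`
  have hEFE : (2 : ℂ) • (β • (Φ * E)) = 0 := by
    have h1 : E * F * E = α • E + β • (Φ * E) := by
      rw [hEFc, add_mul, smul_mul_assoc, smul_mul_assoc, hPE, mul_assoc Φ P E, hPE]
    have h2 : E * F * E = α • E - β • (Φ * E) := by
      rw [mul_assoc E F E, hFEc, mul_sub, mul_smul_comm, mul_smul_comm, hEQ, ← mul_assoc E Φ (1 - P), ← hΦE,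
        mul_assoc Φ E (1 - P), hEQ]
    have h := h1.symm.trans h2
    rw [sub_eq_add_neg] at h
    rw [two_smul, ← eq_neg_iff_add_eq_zero]
    exact add_left_cancel h
  have hFEF : (2 : ℂ) • (β • (Φ * F)) = 0 := by
    have h1 : F * E * F = α • F - β • (Φ * F) := by
      rw [hFEc, sub_mul, smul_mul_assoc, smul_mul_assoc, hQF, mul_assoc Φ (1 - P) F, hQF]
    have h2 : F * E * F = α • F + β • (Φ * F) := by
      rw [mul_assoc F E F, hEFc, mul_add, mul_smul_comm, mul_smul_comm, hFP, ← mul_assoc F Φ P, ← hΦF,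
        mul_assoc Φ F P, hFP]
    have h := h2.symm.trans h1
    rw [sub_eq_add_neg] at h
    rw [two_smul, ← eq_neg_iff_add_eq_zero]
    exact add_left_cancel h
  -- `β ≠ 0`
  have hβ : β ≠ 0 := by
    intro hβ0
    have hEF0 : E * F - F * E = α • ((2 : ℂ) • P - 1) := by rw [hEF, hβ0, zero_smul, add_zero]
    have hEF' : E * F = α • P := by rw [hEFc, hβ0, zero_smul, add_zero]
    have hFE' : F * E = α • (1 - P) := by rw [hFEc, hβ0, zero_smul, sub_zero]
    have hα : α ≠ 0 := fun hα0 => hFE0 (by rw [hFE', hα0, zero_smul])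
    have hP0 : P ≠ 0 := fun h => hE0 (by rw [← hPE, h, zero_mul])
    -- the commutant of `{P, E, F}`
    set C : Submodule ℂ (Module.End ℂ (ℂ ⊗[ℚ] V)) :=
      LinearMap.ker (LinearMap.mulRight ℂ P - LinearMap.mulLeft ℂ P) ⊓
        LinearMap.ker (LinearMap.mulRight ℂ E - LinearMap.mulLeft ℂ E) ⊓
        LinearMap.ker (LinearMap.mulRight ℂ F - LinearMap.mulLeft ℂ F) with hCdef
    have hC : ∀ T, T ∈ C ↔ T * P = P * T ∧ T * E = E * T ∧ T * F = F * T := by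
      intro T
      simp only [hCdef, Submodule.mem_inf, LinearMap.mem_ker, LinearMap.sub_apply, LinearMap.mulRight_apply,
        LinearMap.mulLeft_apply, sub_eq_zero, and_assoc]
    -- rational brackets and their commutant
    set brk : Set (Module.End ℚ V) := (fun p : Module.End ℚ V × Module.End ℚ V => p.1 * p.2 - p.2 * p.1) ''
      ((H.hodgeLie : Set (Module.End ℚ V)) ×ˢ (H.hodgeLie : Set (Module.End ℚ V))) with hbrk
    have hb : ∀ b : Module.End ℚ V, (∀ s ∈ brk, b * s = s * b) → b * φ = φ * b := by
      intro b hb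
      have hbEF : b.baseChange ℂ * (E * F - F * E) = (E * F - F * E) * b.baseChange ℂ := by
        have hmem := commutator_mem_span_brackets H hEM hFM
        refine Submodule.span_induction (p := fun T _ => b.baseChange ℂ * T = T * b.baseChange ℂ) ?_ ?_ ?_ ?_ hmem
        · rintro _ ⟨⟨X₁, X₂⟩, ⟨hX₁, hX₂⟩, rfl⟩
          have h := congrArg (LinearMap.baseChange ℂ) (hb _ ⟨(X₁, X₂), ⟨hX₁, hX₂⟩, rfl⟩)
          simp only [LinearMap.baseChange_mul, LinearMap.baseChange_sub] at h
          exact h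
        · rw [mul_zero, zero_mul]
        · intro x y _ _ hx hy; rw [mul_add, add_mul, hx, hy]
        · intro c x _ hx; rw [mul_smul_comm, smul_mul_assoc, hx]
      have hbΘ : b.baseChange ℂ * ((2 : ℂ) • P - 1) = ((2 : ℂ) • P - 1) * b.baseChange ℂ := by
        rw [hEF0, mul_smul_comm, smul_mul_assoc] at hbEF
        exact smul_right_injective _ hα hbEF
      have hbP : b.baseChange ℂ * P = P * b.baseChange ℂ := by
        rw [mul_sub _ _ (1 : Module.End ℂ (ℂ ⊗[ℚ] V)), sub_mul _ (1 : Module.End ℂ (ℂ ⊗[ℚ] V)), mul_one, one_mul,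
          mul_smul_comm, smul_mul_assoc, sub_left_inj] at hbΘ
        exact smul_right_injective _ (two_ne_zero' ℂ) hbΘ
      have hbA : b ∈ H.endAlg :=
        mem_endAlg_of_projE_eq_zero H e hF hdeg (blocks_D hPP hbP).1 (blocks_D hPP hbP).2
      exact (hφcA b hbA).symm
    -- every `T ∈ C` commutes with `Φ`
    have hkey : ∀ T ∈ C, T * Φ = Φ * T := by
      intro T hT
      obtain ⟨hTP, hTE, hTF⟩ := (hC T).1 hT
      have hTΘ : T * ((2 : ℂ) • P - 1) = ((2 : ℂ) • P - 1) * T := by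
        rw [mul_sub T _ 1, sub_mul _ 1 T, mul_smul_comm, smul_mul_assoc, hTP, mul_one, one_mul]
      -- `T` commutes with all brackets of `𝔥_ℂ`
      have hTbr : ∀ W ∈ H.hodgeLieC, ∀ W' ∈ H.hodgeLieC, T * (W * W' - W' * W) = (W * W' - W' * W) * T := by
        intro W hW W' hW'
        obtain ⟨w, hw⟩ := hspan W hW
        obtain ⟨w', hw'⟩ := hspan W' hW'
        set W₀ := w 0 • ((2 : ℂ) • P - 1) + w 1 • E + w 2 • F with hW₀
        set W₀' := w' 0 • ((2 : ℂ) • P - 1) + w' 1 • E + w' 2 • F with hW₀'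
        have hW₀M : W₀ ∈ H.hodgeLieC := H.hodgeLieC.add_mem (H.hodgeLieC.add_mem (H.hodgeLieC.smul_mem _ hΘ')
          (H.hodgeLieC.smul_mem _ hEM)) (H.hodgeLieC.smul_mem _ hFM)
        have hW₀'M : W₀' ∈ H.hodgeLieC := H.hodgeLieC.add_mem (H.hodgeLieC.add_mem (H.hodgeLieC.smul_mem _ hΘ')
          (H.hodgeLieC.smul_mem _ hEM)) (H.hodgeLieC.smul_mem _ hFM)
        have hc₀ : Φ * W₀ = W₀ * Φ := hΦcen _ hW₀M
        have hc₀' : Φ * W₀' = W₀' * Φ := hΦcen _ hW₀'M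
        have hred : W * W' - W' * W = W₀ * W₀' - W₀' * W₀ := by
          rw [hw, hw']
          simp only [add_mul, mul_add, smul_mul_assoc, mul_smul_comm, hc₀, hc₀']
          module
        have hT₀ : T * W₀ = W₀ * T := by
          simp only [hW₀, mul_add, add_mul, mul_smul_comm, smul_mul_assoc, hTΘ, hTE, hTF]
        have hT₀' : T * W₀' = W₀' * T := by
          simp only [hW₀', mul_add, add_mul, mul_smul_comm, smul_mul_assoc, hTΘ, hTE, hTF]
        rw [hred]
        exact commute_bracket hT₀ hT₀'
      have hTs : ∀ s ∈ brk, T * s.baseChange ℂ = s.baseChange ℂ * T := by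
        rintro _ ⟨⟨X₁, X₂⟩, ⟨hX₁, hX₂⟩, rfl⟩
        simp only [LinearMap.baseChange_sub, LinearMap.baseChange_mul]
        exact hTbr _ (H.baseChange_mem_hodgeLieC hX₁) _ (H.baseChange_mem_hodgeLieC hX₂)
      have hTmem := mem_span_baseChange_of_forall_commute brk hTs
      refine Submodule.span_induction (p := fun T _ => T * Φ = Φ * T) ?_ ?_ ?_ ?_ hTmem
      · rintro _ ⟨b, hb', rfl⟩
        rw [hΦdef, ← LinearMap.baseChange_mul, ← LinearMap.baseChange_mul, hb b hb']
      · rw [mul_zero, zero_mul]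
      · intro x y _ _ hx hy; rw [mul_add, add_mul, hx, hy]
      · intro c x _ hx; rw [mul_smul_comm, smul_mul_assoc, hx]
    -- `Φ` is a central element of the commutant of the triple, hence a scalar
    have hΦC : Φ ∈ C := (hC Φ).2 ⟨hΦP, hΦE, hΦF⟩
    obtain ⟨c, hc⟩ := SL2Triple.exists_eq_smul_one_of_mem_center_commutant hα hPP hPE hEP hPF hFP hEF' hFE' hP0 hC
      hΦC (fun T' hT' => (hkey T' hT').symm)
    -- descent: `φ ∈ ℚ · id`, contradicting `id ∉ 𝔥`
    have hmem : φ ∈ ℚ ∙ (1 : Module.End ℚ V) := by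
      apply mem_of_one_tmul_mem_baseChange
      have key : ((1 : ℂ) ⊗ₜ[ℚ] φ : ℂ ⊗[ℚ] Module.End ℚ V) = c • ((1 : ℂ) ⊗ₜ[ℚ] (1 : Module.End ℚ V)) := by
        apply (endBaseChangeEquiv V).injective
        rw [map_smul, endBaseChangeEquiv_tmul, endBaseChangeEquiv_tmul, one_smul, one_smul, ← hΦdef, hc,
          Module.End.one_eq_id, Module.End.one_eq_id, LinearMap.baseChange_id]
      rw [key]
      exact Submodule.smul_mem _ _ (Submodule.tmul_mem_baseChange_of_mem 1 (Submodule.mem_span_singleton_self _))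
    obtain ⟨q, hq⟩ := Submodule.mem_span_singleton.1 hmem
    have hq0 : q ≠ 0 := by
      rintro rfl
      exact hφ0 (by rw [← hq, zero_smul])
    haveI : Nontrivial V := by
      by_contra hV
      rw [not_nontrivial_iff_subsingleton] at hV
      exact hφ0 (LinearMap.ext fun v => Subsingleton.elim _ _)
    apply id_notMem_hodgeLie H ψ
    have h := H.hodgeLie.smul_mem q⁻¹ hφh
    rw [← hq, smul_smul, inv_mul_cancel₀ hq0, one_smul, Module.End.one_eq_id] at h
    exact h
  -- conclusion
  have hβ2 : (2 : ℂ) * β ≠ 0 := mul_ne_zero (two_ne_zero' ℂ) hβ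
  have hΦE0 : Φ * E = 0 := by
    rw [smul_smul] at hEFE
    exact (smul_eq_zero.1 hEFE).resolve_left hβ2
  have hΦF0 : Φ * F = 0 := by
    rw [smul_smul] at hFEF
    exact (smul_eq_zero.1 hFEF).resolve_left hβ2
  exact ⟨φ, hφh, hφ0, hφA, hφcA, hli, hspan, hΦE0, hΦF0, α, β, hβ, hEF⟩

end HodgeStructure

end Literature.AlgebraicGeometry.Motives

end
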